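import Mathlib
import HarnessLib
import HarnessLib.Audit
import Summits.HubbardSuperconductivity.Statement
import Literature.Barriers.HubbardSuperconductivity.PureModelStripeCompetition
import Literature.MathematicalPhysics.QuantumLattice.FermionQuasiFree
import HarnessLib.Audit.Status.Attr

/-!
Route: ParityLeeYang

DORMANT since 2026-08-22T10:25:40Z (reconciler: no traction for 5.3 d (last activity item-evidence-added at 2026-08-17T03:12:26Z); parked, not closed — `ledger route dormant route-HubbardSuperconductivity-ParityLeeYang --off` to reactiv) — unstaffed, not closed; items shared with open routes are served there. `ledger route dormant <id> --off` reactivates.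

# Route ParityLeeYang — pairing lets go of the axis — parity-twisted Z of the repulsive Hubbard
torus positive on a doping window at fixed low T (no Lee–Yang zero on the Roberge–Weiss line), then
a coherence bridge

X = ParityPositiveWindow ∧ ParityBridge (realises idea card parity-twisted-lee-yang-interlacing).
Object: the
parity-twisted grand-canonical partition function of the pure Hubbard torus, Z_P(β,U,μ,L) := Re
Tr[(−1)^N̂ e^{−β(H_L−μN̂)}]
= Z_L(β, μ+iπ/β) (`(parityOp * (hubbardTorusWith 2 L 1 U μ).gibbsWeight β).trace.re`), i.e. the
fugacity polynomial
Σ_N Z_N z^N evaluated on the NEGATIVE axis z = −e^{βμ}; its sign changes in μ are the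
odd-multiplicity Lee–Yang zeros on
the Roberge–Weiss line Im μ = πT. ParityPositiveWindow (the pairing half, card K1): for some U > 0,
a hole-doping window
0 < δ₁ < δ₂ < 2/5, a μ-window [μ₁, μ₂] and β₀, for every β ≥ β₀ and all large even L, the Gibbs
density at μ₁ is
≤ (1−δ₂)L², at μ₂ is ≥ (1−δ₁)L² (the window is swept, compressibly) and Z_P > 0 for every μ ∈ [μ₁,
μ₂] — a U(1)-symmetric,
positive-temperature, finite-volume, SIGN-valued statement (thermodynamic limit at fixed T first).
ParityBridge (the
coherence half, card K3): such a window forces d_{x²−y²} pair-field LRO of every sector ground-state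
sequence at some
δ ∈ [δ₁, δ₂] (`HasDWavePairFieldLROAt U δ`).
Lean: `ParityPositiveWindow ∧ ParityBridge`

## Assembly
Pure logic (proved rc 0 in the planner's Sketch.lean, 6 lines): take (U, δ₁, δ₂, μ₁, μ₂, β₀) and the
window data from
ParityPositiveWindow, feed ParityBridge to get δ ∈ [δ₁, δ₂] ⊂ (0, 2/5) ⊂ (0, 1/2) with
HasDWavePairFieldLROAt U δ, and
close by unfolding HubbardSuperconductivity / DWaveSuperconductivityHubbard (two linariths).
WeakRepulsionOnAxis and the
three supports are calibrations of the dictionary (they make the sign datum meaningful) and do not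
enter the implication.

Rationale: WHY THIS LINE. Superconductivity is read as a ZERO-LOCATION event: at U = 0 the fugacity zeros of
the torus are real, negative and
Kramers-DOUBLE (Z_P = det(1−e^{−βh})² ≥ 0, support FreeParityDet), so the free gas sits exactly on
the real-rootedness
boundary — indeed its parity bias Π_k tanh²(βξ_k/2) = e^{−π²N(0)TL²(1+o(1))} and the
Poisson/Gaussian smearing
e^{−π²κTL²/2} (κTL² = Var N = 2N(0)TL²) have the SAME exponent; attraction rotates every doublet off
the axis (U ≤ 0 ⇒
Z_P ≥ 0 for all β, μ, any graph, by the charge Hubbard–Stratonovich square det(1−xB_s)², Hirsch1983,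
BlankenbeclerScalapinoSugar1981: support AttractiveParityNonneg), repulsion splits it ALONG the axis
at first order
(E₂ > 2E₁ strictly for every U > 0 at the non-degenerate band bottom: support BandBottomOnAxis —
Bach–Lieb–Solovej's
no-pairing theorem BachLiebSolovej1994 read on the fugacity axis), and a paired state has bias
e^{−4N_qp(T)} ≫ e^{−π²κTL²/2}
(JankoSmithAmbegaokar1994, MatveevLarkin1997, VonDelftRalph2001 §4), hence Z_P > 0. Imported areas:
Lee–Yang theory
(LeeYang1952) and imaginary chemical potential (RobergeWeiss1986, WakayamaEtAl2019), real-rootedness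
of positive
combinations via common interlacing (HeilmannLieb1972, ChudnovskySeymour2007,
MarcusSpielmanSrivastava2015) as the intended
engine for the repulsive spin-HS form Z_P = Σ_s c_s det(1−xB_s)det(1−xB_{−s}), and the mesoscopic
parity effect. What no
prior route does: SpinStructureRigidity reads the MAGNITUDE |Z_P/Z| at β = κL, ParityGapRigidity
needs a UNIFORM T = 0
parity gap that nodal d-wave lacks; here the datum is the SIGN at fixed T, which nodal d-wave
satisfies, with theorems on
both calibration sides and a thermodynamic on-axis crux for the weakly repulsive normal state.
Negatives index: empty.

RANKED CRUXES. #0 Thesis (target) — X = ParityPositiveWindow ∧ ParityBridge as in § Thesis. (why it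
might fail: the pure t'=0 model may own no compressible parity-positive window (stripes, e^{-c/U²}
scales), and positivity certifies local pairing only, not coherence.) [ArovasBergKivelsonRaghu2022,
JankoSmithAmbegaokar1994, QinEtAl2020]
#2 ParityPositiveWindow (crux) — card K1. ∃ U > 0, 0 < δ₁ < δ₂ < 2/5, μ₁ < μ₂, β₀ > 0 such that for
every β ≥ β₀ there is L₀ with, for all even L ≥ L₀: Gibbs density of hubbardTorusWith 2 L 1 U μ₁ at
β is ≤ (1−δ₂)L², at μ₂ is ≥ (1−δ₁)L², and Re Tr[parityOp · e^{−β(H_L−μN)}] > 0 for every μ ∈ [μ₁,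
μ₂] (no odd-multiplicity Lee–Yang zero on the negative fugacity axis over the window; N_sc = 0; L →
∞ at fixed T first, the Mermin–Wagner-safe order). [difficulty: open-problem] (why it might fail:
Needs a COMPRESSIBLE paired window of the pure t'=0 model: stripes/plateaus at U≳6 give sign flips
for L≡2 mod 4, weak-U pairing scales e^{-c/U²} push β₀ out of reach, and beyond BdG residual
quasiparticle repulsion may re-split zeros onto the axis.) [ArovasBergKivelsonRaghu2022,
AbrahamEtAl1996, JankoSmithAmbegaokar1994, MatveevLarkin1997, QinEtAl2020]
#3 ParityBridge (crux) — card K3, the coherence half. For all U > 0, 0 < δ₁ < δ₂ < 2/5, μ₁ < μ₂, β₀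
> 0: if the window data of ParityPositiveWindow hold (density sweep + Z_P > 0 on [μ₁, μ₂] for every
β ≥ β₀, eventually in even L), then HasDWavePairFieldLROAt U δ for some δ ∈ [δ₁, δ₂] (every
normalised (N_L, S^z=0)-sector ground-state sequence has d_{x²−y²} pair-field LRO along even L).
[deps: ParityPositiveWindow] [difficulty: open-problem] (why it might fail: Positivity certifies
LOCAL pairing only: U<0 is parity-positive at every β, μ, L with no T>0 order; incoherent pair
states (PDW, pair crystal, phase separation), non-B1g condensates (d_xy/p near n≈0.6) and the
GC(μ)→every-sector-GS descent are unguarded.) [TasakiWatanabe2021, ElseThorngrenSenthil2021,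
KomaTasaki1994, RaghuKivelsonScalapino2010, Scalapino1995]
#4 WeakRepulsionOnAxis (crux) — card K2/T3 made thermodynamic (the dictionary is not vacuous on the
repulsive side): for every β > 0 and every μ-window [μ₁, μ₂] ⊂ (−4, 4) inside the free band there is
U₁ > 0 such that for all U ∈ (0, U₁), eventually in even L, Z_P(β,U,μ,L) < 0 for some μ ∈ [μ₁, μ₂] —
weak repulsion at fixed temperature splits the dense Kramers double zeros ALONG the Roberge–Weiss
line (sign changes), as first-order on-axis splitting (BLS on the fugacity axis) predicts.
[difficulty: L] (why it might fail: At U=0 bias and Gaussian smearing tie exactly (exponent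
π²N(0)TL² both), so the O(U) competition on the line Im μ=πT is delicate; torus shells are 4-8-fold
degenerate with zero first-order odd-N curvature; the zero Matsubara mode makes log Z_P expansions
singular at the zeros.) [BachLiebSolovej1994, BenfattoGiulianiMastropietro2006, PedraSalmhofer2008,
RobergeWeiss1986, Hirsch1983]
#9 AttractiveParityNonneg (support) — card T2/P1, Literature-grade calibration: on every finite
graph, for every hopping t, every U ≤ 0, μ ∈ ℝ and β ≥ 0, Re Tr[parityOp · e^{−β(H(t,U)−μN)}] ≥ 0
(discrete charge Hubbard–Stratonovich: each Trotter term is c_s·det(1 − e^{βμ}B_s)² with c_s > 0 and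
B_s real; limit of non-negative reals). Hence real fugacity zeros of the attractive model have even
multiplicity and Z_even(μ) ≥ Z_odd(μ). [difficulty: L] [Hirsch1983, BlankenbeclerScalapinoSugar1981,
JankoSmithAmbegaokar1994]
#9 FreeParityDet (support) — card T1: at U = 0 the parity-twisted Gaussian trace is a determinant,
Tr[parityOp · e^{−β dΓ(h)}] = det(1 − e^{−βh}) with h = hubbardOneBody G t μ (spin-diagonal with
identical blocks, so the value is a perfect square ≥ 0 and every real fugacity zero z = −e^{βε_k} is
double: the free gas sits ON the real-rootedness boundary). [difficulty: provable-now]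
[BenfattoGiulianiMastropietro2006, JankoSmithAmbegaokar1994]
#9 BandBottomOnAxis (support) — card T3 in its cleanest instance (provable now, no perturbation
theory): on the torus (ℤ/Lℤ)², L ≥ 2, t = 1, for EVERY U > 0 there is β₁ such that for all β ≥ β₁
some μ has Z_P(β,U,μ,L) < 0. Proof sketch: E₀ = 0, E₁ = λ_min(h); the one-body ground state is
non-degenerate (Perron), so E₂ = 2E₁ would force the singlet φ₀⊗φ₀ with ⟨D⟩ = Σ|φ₀|⁴ > 0, hence g :=
E₂ − 2E₁ > 0; with γ the one-body gap and μ = E₁ + min(g,γ)/4 the N = 1 term −Z₁e^{βμ} ≤ −2e^{βη}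
dominates 1 and all N ≥ 2 terms (Pauli: E_N ≥ NE₁ + (N−2)γ) as β → ∞. [difficulty: provable-now]
[BachLiebSolovej1994, LeeYang1952]

TWO-LAYER PLAN. Foreseen glued splits (k ≤ 3, depth 1; nothing filed now): ParityPositiveWindow ⇐
ParityBiasLowerBound (a systematic
even/odd free-energy bias p_L(β,μ) ≥ e^{−c(β)L²} with c(β) < π²κ(β)/(2β) on the window) →
NumberLocalCLT (log-concave /
Gaussian canonical weights Z_N e^{βμN} at scale κTL², Poisson summation = card T5) →
ParityPositiveWindow.
ParityBridge ⇐ EnsembleDescent (GC(μ, β → ∞ after L → ∞) to every (N_L, 0)-sector ground state) →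
PairCoherence
(local pairing certified by the bias + compressibility ⇒ B1g condensate; the LSM/anomaly-type step
shared in spirit with
ParityGapRigidity.IncommensurateRigidity) → ParityBridge. WeakRepulsionOnAxis ⇐ RWLineExpansion
(convergent weak-coupling
expansion of log Z_L(β, μ+iy) for |y| < π/β, uniform up to the line away from the free zeros) →
ZeroSplittingSign (the
collective first-order splitting direction of the Kramers doublets is along the line) →
WeakRepulsionOnAxis.

KILL CRITERIA. (a) WeakRepulsionOnAxis refuted in the strong form "Z_P ≥ 0 on a band window for all
small U > 0 at some fixed β,
eventually in L" — zeros leave the axis under weak REPULSION too — empties the dictionary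
(positivity would not signal
pairing): close `refuted:WeakRepulsionOnAxis` unless the refutation is confined to a measure-zero
set of μ. (b)
ParityPositiveWindow refuted (for every U > 0 and window, sign changes persist at all β along
infinitely many even L):
close `refuted:ParityPositiveWindow`; the supports survive as Literature facts. (c) ParityBridge
refuted inside the
Hubbard family (a compressible parity-positive window without d-wave LRO: triplet/d_xy condensate,
PDW, pair crystal):
restate once with an explicit B1g-selection / no-density-wave hypothesis, else close. (d)
HasDWavePairFieldLROAt proved
elsewhere for some (U, δ) moots the route (supports still worth landing).

NOT DECOMPOSED YET. The interlacing ENGINE proper (spin-HS sector polynomials det(1−xB_s), a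
real-spectrum lemma for the Trotter products,
"pairwise compatibility on HS-measure ≥ 1−ε ⇒ ≥ (2−Cε)·#levels sign changes" à la
ChudnovskySeymour2007 §3) — it is proof
technology for WeakRepulsionOnAxis / against ParityPositiveWindow and rides as `--supports` lemmas,
never as items; the
tropical corner T4 (degeneracy-threshold law βD_N > log(g_N²/4g_{N−1}g_{N+1}), finite L, β → ∞ —
finite-torus
Kohn–Luttinger layer, shared with card finite-torus-cooper-log); the Trotter/HS formalisation behind
AttractiveParityNonneg;
constants β₀(U), U₁(β); the negative-side corollary "N_sc extensive at large U / high T ⇒ no parity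
bias there".

CHEAPEST FALSIFIER. Exact diagonalisation census the refuter can run first: full sector spectra of
the 4×4 torus (and canonical Z_N of
6×6 / √20×√20 by finite-T Lanczos) give Z_P(β,U,μ,L) exactly; scan μ over densities 0.60–0.95 at U =
2, 4, 8 and β = 2…10
and count sign changes N_sc, against the U = −4 twin (must be 0 by AttractiveParityNonneg) and U = 0
(touching zeros).
Dictionary dead if the repulsive tori show N_sc = 0 already at HIGH T (β ≤ 1) — that also kills
WeakRepulsionOnAxis's
premise — or if N_sc stays ≈ 2·#levels down to the lowest β at every U with no window opening as L
grows 4 → 6. Second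
instrument: the DQMC estimator ⟨(−1)^N⟩ = ⟨det(1−B↑)det(1−B↓)⟩/⟨det(1+B↑)det(1+B↓)⟩ at U = 4, β = 5,
L = 4…10 (the
region where AbrahamEtAl1996 saw fugacity zeros drift toward θ = π/2). The card's own mini-ED (≤ 10
sites) found: U = −4
⇒ N_sc = 0 everywhere; U = 4 rings/ladders ⇒ N_sc = 2·#levels, min⟨(−1)^N⟩ = −0.31; √8×√8 at U = 1,
4, 8 ⇒ odd-shell
concavity D_N ≤ 0.126 (the finite-size KL layer) — no kit job ids (compute daemon was down for that
seat).

NUMBERS. Free gas: −log⟨(−1)^N⟩ = π²N(0)TL²(1+o(1)) (∫_ℝ −log tanh²(|x|/2)dx = π²) = exactly the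
Poisson threshold π²κTL²/2 with
κT L² = Var N = 2N(0)TL² (boundary case). BdG: ⟨(−1)^N⟩ = Π_k tanh²(βE_k/2) = e^{−4N_qp(T)}; nodal
d-wave N_qp ≈ c L²T²/(v_F v_Δ)
⇒ positivity wins iff T ≲ (π²/8)κ v_F v_Δ/c, so β₀(U) ~ 1/Δ_d(U) ~ e^{+C/U²} at weak coupling
(WeakCouplingCeiling's
floor T > e^{−a/U}). Atomic limit U > 0: ⟨(−1)^N⟩ = m(μ)^{L²} ≥ 0 with L²-fold zeros at the two
density crossovers (t = 0
is on the boundary like U = 0). Band-bottom gap g = E₂ − 2E₁ ∈ (0, U/L²]. AbrahamEtAl1996: β = 5, U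
= 4, lattices 4²–10²,
zero density increasing near θ = π/2. Doping window capped at δ₂ < 2/5 (d_{x²−y²} is the
weak-coupling leader only for
0.6 < n < 1, RaghuKivelsonScalapino2010 §III.B). Items at open: 8 (1 target, 3 cruxes, 3 supports, 1
assembly).

DEFINITION REQUESTS. None needed to state the items (parityOp, hubbardTorusWith, hamiltonianWith,
hubbardOneBody, Matrix.gibbsWeight /
gibbsState, totalNumber, HasDWavePairFieldLROAt all exist). Nice-to-have later (not filed):
`fugacityPolynomial H β :
Polynomial ℂ` (Σ_N Tr_N e^{−βH} X^N) to speak of zero multiplicities directly.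

Novelty: Searches (2026-08-15, this seat): `lit search "Lee-Yang zeros Hubbard model complex chemical
potential fugacity expansion"`
(25 rows: AbrahamEtAl1996 + Physica C 1994 / 1995 proceedings of the same group, Jauslin–Lebowitz
2018 hard-core, lattice-QCD
canonical approaches); `lit search --source crossref "Roberge-Weiss imaginary chemical potential
fermion number parity Lee-Yang
zeros pairing"` (20 rows: RobergeWeiss1986, Alford–Kapustin–Wilczek 1999, Filothodoros 2017; none on
pairing); crossref
"parity projected BCS odd even grand canonical partition function complex chemical potential" (15
rows: Balian–Flocard–Vénéroni
N-parity projected BCS, Kuriyama et al. 2002); crossref "parity projected superconducting grains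
Janko Smith Ambegaokar" (12
rows: JankoSmithAmbegaokar1994, MatveevLarkin1997, VanhouckeRomboutsPollet2006 = QMC parity effect
at T>0 in the Richardson
model); `lit frontier HubbardSuperconductivity --since 2021` (30 rows, nothing on partition-function
zeros or parity signs);
`lit galaxy search --star all "Yang-Lee zeros"` (13 rows: Ising, QCD — WakayamaEtAl2019 —,
econophysics), galaxy "Lee-Yang
zeros of the Hubbard model", "fermion number parity partition function zeros", "number parity
projected" (0 rows each);
grep of the 44 Theses files of the sub-problem (zero location / parity sign used by none; nearest
SpinStructureRigidity,
ParityGapRigidity); `lit search --hybrid` unavailable (searchd rc 75), OpenAlex 429 — recorded in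
NOTES.md; plus the card's
audited sear  [refs: AbrahamEtAl1996, RobergeWeiss1986, JankoSmithAmbegaokar1994, MatveevLarkin1997, VanhouckeRomboutsPollet2006, WakayamaEtAl2019, VonDelftRalph2001, HeilmannLieb1972, ChudnovskySeymour2007, MarcusSpielmanSrivastava2015]

Barriers (technique_class: partition-function-zero-location; interlacing): - technique_class: partition-function-zero-location; interlacing
- Literature.Barriers.HubbardSuperconductivity.SignProblemNPHard: not in class — nothing is sampled;
the sign of the signed trace Z_P IS the observable (for U ≤ 0 both Z and Z_P are sign-free squares;
for U > 0 the sign pattern in μ is the datum, handled by zero-location algebra, DQMC only as a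
refuter instrument).
- Literature.Barriers.HubbardSuperconductivity.GeneralizedHartreeFockNoPairing: turned into a
calibration — quasi-free ↑↓-symmetric states give Z_P = det(1−e^{−βh})² (the real-rooted
Kramers-double boundary) and BLS no-pairing reappears as on-axis splitting (BandBottomOnAxis,
WeakRepulsionOnAxis); ParityPositiveWindow measures the departure no repulsive quasi-free state
produces; no variational quasi-free step anywhere.
- Literature.Barriers.HubbardSuperconductivity.PositiveTemperatureNoPairLRO: not engaged — ⟨(−1)^N̂⟩
is U(1)-INVARIANT (the Koma–Tasaki rotation multiplies it by 1) and no Gibbs-state LRO at fixed β is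
claimed; order enters only at T = 0 through ParityBridge.
- Literature.Barriers.HubbardSuperconductivity.HohenbergMerminWagnerPairing: same scope, same
evasion (the fixed-T object is a symmetric partition-function sign, not a pair-field correlator).
- Literature.Barriers.HubbardSuperconductivity.LROForcesLowLyingStates: respected — no anomalous
average is used; the N±2 tower is invisible to (−1)^N̂; the every-GS quantifier is isolated in
ParityBridge where the descent is the named diffic

History (route lifecycle, newest last):
- 2026-08-15T12:45:32Z · rev 1: restated Thesis (stmt-HubbardSuperconductivity-8380) — target spelled out: a rank-0 item renders before the route decls it referenced (ParityPositiveWindow, ParityBridge), so the target is restated as their explicit (planner-plancard-HubbardSuperconductivity-Hub-4ad05cb9-0)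
- 2026-08-22T10:25:40Z · DORMANT — reconciler: no traction for 5.3 d (last activity item-evidence-added at 2026-08-17T03:12:26Z); parked, not closed — `ledger route dormant route-HubbardSupercond (operator:999:3457469)

sub-problem: HubbardSuperconductivity · status: dormant · opened planner-plancard-HubbardSuperconductivity-Hub-4ad05cb9-0 2026-08-15T12:44:04Z · rev 4 · ledger route-HubbardSuperconductivity-ParityLeeYang
GENERATED by the gate from the ledger (D-0016/17). Provers cite these decls: `theorem foo : Summit.HubbardSuperconductivity.HubbardSuperconductivity.Theses.ParityLeeYang.<Decl> := …` in Summits/HubbardSuperconductivity/HubbardSuperconductivity/Theorems/<Name>.lean.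
-/

namespace Summit.HubbardSuperconductivity.HubbardSuperconductivity.Theses.ParityLeeYang

open scoped BigOperators Topology Manifold Classical MeasureTheory ProbabilityTheory Matrix InnerProductSpace ComplexConjugate ContinuousMap
open Filter Set Function TopologicalSpace MeasureTheory

attribute [summit_statement] _root_.HubbardSuperconductivity

open Literature.Hubbard

-- earlier Thesis (stmt-HubbardSuperconductivity-8380, replaced 2026-08-15T12:45:32Z -> stmt-HubbardSuperconductivity-8389): retired by None — ParityPositiveWindow ∧ ParityBridge
/-- item stmt-HubbardSuperconductivity-8389 · target · rank 0 · open · by planner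
why it might fail: Conjunction of two open halves: the pure t'=0 torus may own no compressible parity-positive (spin-gapped, paired) doping window at all — stripes win at U≈8, δ≈1/8 and weak-U scales are e^{-c/U²} — and Z_P>0 certifies a spin/parity gap, not B1g phase coherence of every sector ground state.
sources: QinEtAl2020, ArovasBergKivelsonRaghu2022, JankoSmithAmbegaokar1994, EmeryKivelson1995
[target] X = ParityPositiveWindow ∧ ParityBridge as in § Thesis. -/
@[route_item "route-HubbardSuperconductivity-ParityLeeYang"]
def Thesis : Prop :=
  (∃ U : ℝ, 0 < U ∧ ∃ δ₁ δ₂ : ℝ, 0 < δ₁ ∧ δ₁ < δ₂ ∧ δ₂ < 2 / 5 ∧ ∃ μ₁ μ₂ : ℝ, μ₁ < μ₂ ∧ ∃ β₀ : ℝ, 0 < β₀ ∧ ∀ β : ℝ, β₀ ≤ β → ∃ L₀ : ℕ, ∀ L : ℕ, Even L → L₀ ≤ L → ((Literature.MathematicalPhysics.QuantumLattice.hubbardTorusWith 2 L 1 U μ₁).gibbsState β Literature.MathematicalPhysics.QuantumLattice.totalNumber).re ≤ (1 - δ₂) * (L : ℝ) ^ 2 ∧ (1 - δ₁) * (L : ℝ)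 ^ 2 ≤ ((Literature.MathematicalPhysics.QuantumLattice.hubbardTorusWith 2 L 1 U μ₂).gibbsState β Literature.MathematicalPhysics.QuantumLattice.totalNumber).re ∧ ∀ μ ∈ Set.Icc μ₁ μ₂, 0 < (Literature.MathematicalPhysics.QuantumLattice.parityOp * (Literature.MathematicalPhysics.QuantumLattice.hubbardTorusWith 2 L 1 U μ).gibbsWeight β).trace.re) ∧ (∀ (U δ₁ δ₂ μ₁ μ₂ β₀ : ℝ), 0 < U → 0 < δ₁ → δ₁ < δ₂ → δ₂ < 2 / 5 → μ₁ < μ₂ → 0 < β₀ → (∀ β : ℝ, β₀ ≤ β → ∃ L₀ : ℕ, ∀ L : ℕ, Even L → L₀ ≤ L → ((Literature.MathematicalPhysics.QuantumLattice.hubbardTorusWith 2 L 1 U μ₁).gibbsState β Literature.MathematicalPhysics.QuantumLattice.totalNumber).re ≤ (1 - δ₂) * (L : ℝ) ^ 2 ∧ (1 - δ₁) * (L : ℝ) ^ 2 ≤ ((Literature.MathematicalPhysics.QuantumLattice.hubbardTorusWith 2 L 1 U μ₂).gibbsState β Literature.MathematicalPhysics.QuantumLattice.totalNumber).re ∧ ∀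 μ ∈ Set.Icc μ₁ μ₂, 0 < (Literature.MathematicalPhysics.QuantumLattice.parityOp * (Literature.MathematicalPhysics.QuantumLattice.hubbardTorusWith 2 L 1 U μ).gibbsWeight β).trace.re) → ∃ δ ∈ Set.Icc δ₁ δ₂, Literature.Barriers.HubbardSuperconductivity.HasDWavePairFieldLROAt U δ)

/-- item stmt-HubbardSuperconductivity-8381 · crux · rank 2 · open · by planner
why it might fail: Pure t'=0 Hubbard may have NO paired compressible window: DMRG/AFQMC give filled stripes, not SC, at U≈6-8, δ≈1/8 (SC needs t'≠0); at weak U pairing scales are e^{-c/U²}; and Z_P>0 with L→∞ first needs the spin-fluctuation rate 2π²χ_s(T)T below the charge rate π²κT/2 at EVERY β≥β₀.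
sources: QinEtAl2020, XuEtAl2024, ArovasBergKivelsonRaghu2022, AbrahamEtAl1996, JankoSmithAmbegaokar1994, MatveevLarkin1997
[crux] card K1. ∃ U > 0, 0 < δ₁ < δ₂ < 2/5, μ₁ < μ₂, β₀ > 0 such that for every β ≥ β₀ there is L₀
with, for all even L ≥ L₀: Gibbs density of hubbardTorusWith 2 L 1 U μ₁ at β is ≤ (1−δ₂)L², at μ₂ is
≥ (1−δ₁)L², and Re Tr[parityOp · e^{−β(H_L−μN)}] > 0 for every μ ∈ [μ₁, μ₂] (no odd-multiplicity
Lee–Yang zero on the negative fugacity axis over the window; N_sc = 0; L → ∞ at fixed T first, the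
Mermin–Wagner-safe order). [difficulty: open-problem] -/
@[route_item "route-HubbardSuperconductivity-ParityLeeYang", crux]
def ParityPositiveWindow : Prop :=
  ∃ U : ℝ, 0 < U ∧ ∃ δ₁ δ₂ : ℝ, 0 < δ₁ ∧ δ₁ < δ₂ ∧ δ₂ < 2 / 5 ∧ ∃ μ₁ μ₂ : ℝ, μ₁ < μ₂ ∧ ∃ β₀ : ℝ, 0 < β₀ ∧ ∀ β : ℝ, β₀ ≤ β → ∃ L₀ : ℕ, ∀ L : ℕ, Even L → L₀ ≤ L → ((Literature.MathematicalPhysics.QuantumLattice.hubbardTorusWith 2 L 1 U μ₁).gibbsState β Literature.MathematicalPhysics.QuantumLattice.totalNumber).re ≤ (1 - δ₂) * (L : ℝ) ^ 2 ∧ (1 - δ₁) * (L : ℝ) ^ 2 ≤ ((Literature.MathematicalPhysics.QuantumLattice.hubbardTorusWith 2 L 1 U μ₂).gibbsState β Literature.MathematicalPhysics.QuantumLattice.totalNumber).re ∧ ∀ μ ∈ Set.Icc μ₁ μ₂, 0 < (Literature.MathematicalPhysics.QuantumLattice.parityOp * (Literature.MathematicalPhysics.QuantumLattice.hubbardTorusWith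 2 L 1 U μ).gibbsWeight β).trace.re

/-- item stmt-HubbardSuperconductivity-8382 · crux · rank 3 · open · by planner
why it might fail: Z_P>0 on a compressible window certifies a parity/spin gap (heuristically 4χ_s<κ), not coherence: preformed pairs above T_c, spin-gapped stripes/PDW, d_xy/p condensates near n≈0.6 pass it without d_{x²-y²} LRO; and fixed-T grand-canonical data → EVERY sector ground state is an unguarded descent.
sources: EmeryKivelson1995, ArovasBergKivelsonRaghu2022, RaghuKivelsonScalapino2010, TasakiWatanabe2021, KomaTasaki1994, Scalapino1995
[crux] card K3, the coherence half. For all U > 0, 0 < δ₁ < δ₂ < 2/5, μ₁ < μ₂, β₀ > 0: if the window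
data of ParityPositiveWindow hold (density sweep + Z_P > 0 on [μ₁, μ₂] for every β ≥ β₀, eventually
in even L), then HasDWavePairFieldLROAt U δ for some δ ∈ [δ₁, δ₂] (every normalised (N_L,
S^z=0)-sector ground-state sequence has d_{x²−y²} pair-field LRO along even L). [deps:
ParityPositiveWindow] [difficulty: open-problem] -/
@[route_item "route-HubbardSuperconductivity-ParityLeeYang", crux]
def ParityBridge : Prop :=
  ∀ (U δ₁ δ₂ μ₁ μ₂ β₀ : ℝ), 0 < U → 0 < δ₁ → δ₁ < δ₂ → δ₂ < 2 / 5 → μ₁ < μ₂ → 0 < β₀ → (∀ β : ℝ, β₀ ≤ β → ∃ L₀ : ℕ, ∀ L : ℕ, Even L → L₀ ≤ L → ((Literature.MathematicalPhysics.QuantumLattice.hubbardTorusWith 2 L 1 U μ₁).gibbsState β Literature.MathematicalPhysics.QuantumLattice.totalNumber).re ≤ (1 - δ₂) * (L : ℝ) ^ 2 ∧ (1 - δ₁) * (L : ℝ) ^ 2 ≤ ((Literature.MathematicalPhysics.QuantumLattice.hubbardTorusWith 2 L 1 U μ₂).gibbsState β Literature.MathematicalPhysics.QuantumLattice.totalNumber).re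 ∧ ∀ μ ∈ Set.Icc μ₁ μ₂, 0 < (Literature.MathematicalPhysics.QuantumLattice.parityOp * (Literature.MathematicalPhysics.QuantumLattice.hubbardTorusWith 2 L 1 U μ).gibbsWeight β).trace.re) → ∃ δ ∈ Set.Icc δ₁ δ₂, Literature.Barriers.HubbardSuperconductivity.HasDWavePairFieldLROAt U δ

/-- item stmt-HubbardSuperconductivity-8383 · crux · rank 4 · open · by planner
why it might fail: Asserts the SIGN of an e^{-Θ(TL²)} quantity (odd zeros of Z ON the Roberge-Weiss line Im μ=πT as L→∞): finite-T expansions lose their infrared cutoff there (bosonic zero mode); degenerate torus shells have zero first-order odd-N curvature, so O(U²) Kohn-Luttinger terms may move zeros off-axis.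
sources: BachLiebSolovej1994, BenfattoGiulianiMastropietro2006, PedraSalmhofer2008, RobergeWeiss1986, KohnLuttinger1965, Hirsch1983
[crux] card K2/T3 made thermodynamic (the dictionary is not vacuous on the repulsive side): for
every β > 0 and every μ-window [μ₁, μ₂] ⊂ (−4, 4) inside the free band there is U₁ > 0 such that for
all U ∈ (0, U₁), eventually in even L, Z_P(β,U,μ,L) < 0 for some μ ∈ [μ₁, μ₂] — weak repulsion at
fixed temperature splits the dense Kramers double zeros ALONG the Roberge–Weiss line (sign changes),
as first-order on-axis splitting (BLS on the fugacity axis) predicts. [difficulty: L] -/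
@[route_item "route-HubbardSuperconductivity-ParityLeeYang"]
def WeakRepulsionOnAxis : Prop :=
  ∀ β : ℝ, 0 < β → ∀ μ₁ μ₂ : ℝ, -4 < μ₁ → μ₁ < μ₂ → μ₂ < 4 → ∃ U₁ : ℝ, 0 < U₁ ∧ ∀ U ∈ Set.Ioo (0 : ℝ) U₁, ∃ L₀ : ℕ, ∀ L : ℕ, Even L → L₀ ≤ L → ∃ μ ∈ Set.Icc μ₁ μ₂, (Literature.MathematicalPhysics.QuantumLattice.parityOp * (Literature.MathematicalPhysics.QuantumLattice.hubbardTorusWith 2 L 1 U μ).gibbsWeight β).trace.re < 0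

/-- item stmt-HubbardSuperconductivity-14279 · support · rank 9 · closed · proved by Summit.HubbardSuperconductivity.HubbardSuperconductivity.Theorems.ParityLeeYang.thesisOfWindowAndBridge_proof @ ead4c01e8dfc (prover) · by planner
sources: Scalapino1995, ArovasBergKivelsonRaghu2022
[support] GLUE (target reachability), provable now: ParityPositiveWindow → ParityBridge → Thesis.
The rank-0 target Thesis is, by construction (rev 1, target spelled out because it renders before
the crux decls), word for word the conjunction ParityPositiveWindow ∧ ParityBridge, so `fun hW hB =>
⟨hW, hB⟩` closes this item (planner Sketch.lean, lean check rc 0, 0 sorries; also `example : Thesis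
↔ (ParityPositiveWindow ∧ ParityBridge) := Iff.rfl`). It carries no mathematics: it records in the
item graph that the two cruxes conclude the target, exactly as the deciding theorem `closes hW hB`
concludes the summit. [glue] [deps: ParityPositiveWindow, ParityBridge, Thesis] [difficulty:
provable-now] -/
@[route_item "route-HubbardSuperconductivity-ParityLeeYang"]
def ThesisOfWindowAndBridge : Prop :=
  ParityPositiveWindow → ParityBridge → Thesis

/-- item stmt-HubbardSuperconductivity-8384 · support · rank 9 · closed · proved by Summit.HubbardSuperconductivity.HubbardSuperconductivity.Theorems.ParityLeeYang.attractiveParityNonneg_proof @ 496fefdc4831 (prover) · by planner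
sources: Hirsch1983, BlankenbeclerScalapinoSugar1981, JankoSmithAmbegaokar1994
[support] card T2/P1, Literature-grade calibration: on every finite graph, for every hopping t,
every U ≤ 0, μ ∈ ℝ and β ≥ 0, Re Tr[parityOp · e^{−β(H(t,U)−μN)}] ≥ 0 (discrete charge
Hubbard–Stratonovich: each Trotter term is c_s·det(1 − e^{βμ}B_s)² with c_s > 0 and B_s real; limit
of non-negative reals). Hence real fugacity zeros of the attractive model have even multiplicity and
Z_even(μ) ≥ Z_odd(μ). [difficulty: L] -/
@[route_item "route-HubbardSuperconductivity-ParityLeeYang"]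
def AttractiveParityNonneg : Prop :=
  ∀ {Λ : Type} [LinearOrder Λ] [Fintype Λ] (G : SimpleGraph Λ) [DecidableRel G.Adj] (t U μ β : ℝ), U ≤ 0 → 0 ≤ β → 0 ≤ (Literature.MathematicalPhysics.QuantumLattice.parityOp * (Literature.MathematicalPhysics.QuantumLattice.hamiltonianWith G t U μ).gibbsWeight β).trace.re

/-- item stmt-HubbardSuperconductivity-8385 · support · rank 9 · closed · proved by Summit.HubbardSuperconductivity.HubbardSuperconductivity.Theorems.ParityLeeYang.freeParityDet_proof @ cbbc034b60e4 (prover) · by planner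
sources: BenfattoGiulianiMastropietro2006, JankoSmithAmbegaokar1994
[support] card T1: at U = 0 the parity-twisted Gaussian trace is a determinant, Tr[parityOp · e^{−β
dΓ(h)}] = det(1 − e^{−βh}) with h = hubbardOneBody G t μ (spin-diagonal with identical blocks, so
the value is a perfect square ≥ 0 and every real fugacity zero z = −e^{βε_k} is double: the free gas
sits ON the real-rootedness boundary). [difficulty: provable-now] -/
@[route_item "route-HubbardSuperconductivity-ParityLeeYang"]
def FreeParityDet : Prop :=
  ∀ {Λ : Type} [LinearOrder Λ] [Fintype Λ] (G : SimpleGraph Λ) [DecidableRel G.Adj] (t μ β : ℝ), (Literature.MathematicalPhysics.QuantumLattice.parityOp * (Literature.MathematicalPhysics.QuantumLattice.hamiltonianWith G t 0 μ).gibbsWeight β).trace = (1 - NormedSpace.exp (-(β : ℂ) • Literature.MathematicalPhysics.QuantumLattice.hubbardOneBody G t μ)).det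

/-- item stmt-HubbardSuperconductivity-8386 · support · rank 9 · closed · proved by Summit.HubbardSuperconductivity.HubbardSuperconductivity.Theorems.ParityLeeYang.bandBottomOnAxis_proof @ c8b9ec307be4 (prover) · by planner
sources: BachLiebSolovej1994, LeeYang1952
[support] card T3 in its cleanest instance (provable now, no perturbation theory): on the torus
(ℤ/Lℤ)², L ≥ 2, t = 1, for EVERY U > 0 there is β₁ such that for all β ≥ β₁ some μ has Z_P(β,U,μ,L)
< 0. Proof sketch: E₀ = 0, E₁ = λ_min(h); the one-body ground state is non-degenerate (Perron), so
E₂ = 2E₁ would force the singlet φ₀⊗φ₀ with ⟨D⟩ = Σ|φ₀|⁴ > 0, hence g := E₂ − 2E₁ > 0; with γ the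
one-body gap and μ = E₁ + min(g,γ)/4 the N = 1 term −Z₁e^{βμ} ≤ −2e^{βη} dominates 1 and all N ≥ 2
terms (Pauli: E_N ≥ NE₁ + (N−2)γ) as β → ∞. [difficulty: provable-now] -/
@[route_item "route-HubbardSuperconductivity-ParityLeeYang"]
def BandBottomOnAxis : Prop :=
  ∀ L : ℕ, 2 ≤ L → ∀ U : ℝ, 0 < U → ∃ β₁ : ℝ, ∀ β : ℝ, β₁ ≤ β → ∃ μ : ℝ, (Literature.MathematicalPhysics.QuantumLattice.parityOp * (Literature.MathematicalPhysics.QuantumLattice.hubbardTorusWith 2 L 1 U μ).gibbsWeight β).trace.re < 0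

/-- item stmt-HubbardSuperconductivity-8387 · assembly · rank 1 · closed · proved by Summit.HubbardSuperconductivity.HubbardSuperconductivity.Theorems.parityLeeYang_assembly_proof (prover) · by planner
sources: Scalapino1995, ArovasBergKivelsonRaghu2022
[assembly] ParityPositiveWindow → ParityBridge → HubbardSuperconductivity. -/
@[route_item "route-HubbardSuperconductivity-ParityLeeYang"]
def Assembly : Prop :=
  ParityPositiveWindow → ParityBridge → HubbardSuperconductivity

/-! D-0027 §2.1 — DECIDING THEOREM (planner-authored via `route open/edit --closes-file`; by planner-rbadge-HubbardSuperconductivity-Parity-9cd03f9b-g2-0 2026-08-15T16:14:05Z):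
its hypotheses are this route's items and its conclusion the sub-problem Statement (glue_lint), and it elaborates with this file. -/

@[closes "route-HubbardSuperconductivity-ParityLeeYang"] theorem closes (hW : ParityPositiveWindow) (hB : ParityBridge) : _root_.HubbardSuperconductivity := by
  obtain ⟨U, hU, δ₁, δ₂, hδ₁, hδ₁₂, hδ₂, μ₁, μ₂, hμ, β₀, hβ₀, hwin⟩ := hW
  obtain ⟨δ, hδ, hLRO⟩ := hB U δ₁ δ₂ μ₁ μ₂ β₀ hU hδ₁ hδ₁₂ hδ₂ hμ hβ₀ hwin
  refine ⟨U, hU, δ, ⟨?_, ?_⟩, hLRO⟩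
  · exact lt_of_lt_of_le hδ₁ hδ.1
  · exact lt_of_le_of_lt hδ.2 (by linarith)

end Summit.HubbardSuperconductivity.HubbardSuperconductivity.Theses.ParityLeeYang
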